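import Summits.ResolutionOfSingularities.ResolutionOfSingularities.Theorems.UniversalCellsLocalToGlobalHSTowerDefs
import Summits.ResolutionOfSingularities.ResolutionOfSingularities.Theorems.WeightedInvariantWeightedThesisNormalizationIso
import HarnessLib

/-!
# `LocalToGlobal` (crux stmt-ResolutionOfSingularities-15232, route UniversalCells), line `Sketch`
# (idea `existence-certified-termination`) — stub `stub_step_regular_over_regular`

Helper file (`--supports stmt-ResolutionOfSingularities-15232`; does not close the item).
Objects: `Theorems/UniversalCellsLocalToGlobalHSTowerDefs.lean` (the blind lex-maximal
Hilbert–Samuel tower: `hsCentre`, `hsStep`, `NormalVariety.step`, `stepπ`, `iterπ`, `IsResolvedOver`).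

Statement: for a normal variety `V` over a field `k`, a level `N` and a point `y` of the blind
step `V₁ = (V.step N).X = (Bl_Z V)^ν` whose image `x = (V.stepπ N) y` has a regular local ring,
the local ring `𝒪_{V₁,y}` is regular. Proof: let `B = hsBlowup V.X V.hom N`, `π_B : B → V`,
`ν = normalizationι B`, so `V.stepπ N = ν ≫ π_B` definitionally. The open `U = Reg V`
(`isOpen_regularLocus_of_locallyOfFiniteType_field`) lies in `centreCompl Z` and `π_B` is an
isomorphism over `centreCompl Z` (`hsBlowup.isIso_restrict_centreCompl`), so every point of
`W = π_B⁻¹ U` is regular (`mem_regularLocus_iff_of_isIso_morphismRestrict`, stalk maps of a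
restricted isomorphism are isomorphisms and regularity transports along ring isomorphisms);
`B` is integral, so `ν` is an isomorphism over `W ⊆ Reg B`
(`WeightedThesis.KunzTower.isIso_normalizationι_morphismRestrict_of_subset_regularLocus`); as
`ν y ∈ W`, the same transport gives `y ∈ Reg V₁`.
-/

set_option linter.dupNamespace false -- mandated namespace of this single-conjunct summit

noncomputable section

open CategoryTheory AlgebraicGeometry TopologicalSpace Topology
open AlgebraicGeometry.Scheme.IdealSheafData
open Literature.AlgebraicGeometry.Resolution

namespace Summit.ResolutionOfSingularities.ResolutionOfSingularities.Theorems.LocalToGlobal.HSTower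

/-! ## The stub -/

/-- **Stub `stub_step_regular_over_regular` of line `Sketch` — (the step is an isomorphism over the regular locus).** A point of `V₁` lying over a
regular point of `V` is regular: the centre misses `Reg V`, the blowing-up is an isomorphism
off the centre (`hsBlowup.isIso_restrict_centreCompl`), and the normalization is an isomorphism
over every open inside the regular locus
(`isIso_normalizationι_morphismRestrict_of_subset_regularLocus`); regularity transports along
stalk isomorphisms. [folklore] -/
theorem stub_step_regular_over_regular (k : Type) [Field k] (V : NormalVariety k) (N : ℕ)
    (y : (V.step N).X) (hy : IsRegularLocalRing (V.X.presheaf.stalk ((V.stepπ N).base y))) :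
    IsRegularLocalRing ((V.step N).X.presheaf.stalk y) := by
  obtain ⟨hiso, hsub⟩ := hsBlowup.isIso_restrict_centreCompl V.X V.hom N
  -- the open `Reg V ⊆ V` and its preimage `W` in the blowing-up `B := Bl_Z V`
  let U : V.X.Opens :=
    ⟨Scheme.regularLocus V.X, isOpen_regularLocus_of_locallyOfFiniteType_field V.hom⟩
  -- `B → V` is an isomorphism over `centreCompl ⊇ Reg V`, so `W ⊆ Reg B`
  have hW : ((hsBlowup.π V.X V.hom N ⁻¹ᵁ U : (hsBlowup V.X V.hom N).Opens) :
      Set (hsBlowup V.X V.hom N)) ⊆ Scheme.regularLocus (hsBlowup V.X V.hom N) := fun z hz =>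
    (mem_regularLocus_iff_of_isIso_morphismRestrict (hsBlowup.π V.X V.hom N)
      (centreCompl (hsCentreIdeal V.X V.hom N)) z (hsub hz)).mpr hz
  -- hence the normalization `V₁ = B^ν → B` is an isomorphism over `W`
  haveI : IsIso (normalizationι (hsBlowup V.X V.hom N) ∣_ (hsBlowup.π V.X V.hom N ⁻¹ᵁ U)) :=
    WeightedThesis.KunzTower.isIso_normalizationι_morphismRestrict_of_subset_regularLocus
      (hsBlowup V.X V.hom N) _ hW
  -- `y` lies over `W` (its image in `V` is the given regular point)
  have hyW : (normalizationι (hsBlowup V.X V.hom N)).base y ∈ hsBlowup.π V.X V.hom N ⁻¹ᵁ U :=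
    hy
  exact (mem_regularLocus_iff_of_isIso_morphismRestrict (normalizationι (hsBlowup V.X V.hom N))
    (hsBlowup.π V.X V.hom N ⁻¹ᵁ U) y hyW).mpr (hW hyW)

end Summit.ResolutionOfSingularities.ResolutionOfSingularities.Theorems.LocalToGlobal.HSTower

end
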